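import Mathlib.Combinatorics.SimpleGraph.Cayley
import Mathlib.Algebra.BigOperators.GroupWithZero.Finset
import Mathlib.Algebra.Group.Pi.Lemmas
import Mathlib.Data.Fintype.BigOperators
import Mathlib.Data.Int.Interval
import Mathlib.Analysis.SpecialFunctions.Pow.Real
import Literature.Barriers.CriticalPhenomena.SubexponentialGrowthZd
import HarnessLib

/-!
# Polynomial growth of finitely generated abelian groups: `|B_T(1,n)| ≤ (2n+1)^{|T|}`
# (Wolf 1968, §3; the base case of the Bass–Wolf theorem)

Topic `Literature/GroupTheory/Nilpotent` (section §A of the Bass–Wolf polynomial-growth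
reproduction; companions `GrowthFiniteIndexTransfer` (§T) and the nilpotent core (§N)).  Everything
here is **proved**; theorems only; imports = Mathlib + the tree's ball / volume vocabulary
`graphBall` / `ballVolume` of `Literature.Barriers.CriticalPhenomena.SubexponentialGrowthZd`; the
Cayley graph is Mathlib's `SimpleGraph.mulCayley ↑T` (`u ∼ u t^{±1}`, `t ∈ T`).

Source.  J. A. Wolf, *Growth of finitely generated solvable groups and curvature of Riemannian
manifolds*, J. Differential Geometry **2** (1968) 421–446, §3 (growth of a finitely generated
abelian group is polynomial of degree its rank); W. Woess, *Random Walks on Infinite Graphs and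
Groups*, CUP 2000, §3.B p. 32 ("If `Γ` is a finitely generated abelian group then […]").  The
elementary count formalised here is the one every account starts from: in an abelian group every
word of length `≤ n` in `T ∪ T⁻¹` can be reordered into `∏_{t ∈ T} t^{a_t}` with `|a_t| ≤ n`, and
there are `(2n+1)^{|T|}` such exponent vectors; hence

  `|B_T(1,n)| ≤ (2n+1)^{|T|} ≤ 2^{|T|} (n+1)^{|T|}`      (`ballVolume_mulCayley_le_of_commGroup`,
  `exists_polynomialGrowth_of_commGroup`, and the `[Group A] [IsMulCommutative A]` forms).

## References
* J. A. Wolf, Growth of finitely generated solvable groups and curvature of Riemannian manifolds,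
  J. Differential Geometry 2 (1968) 421–446, §3. [WolfGrowth1968]
* W. Woess, Random Walks on Infinite Graphs and Groups, Cambridge Tracts in Math. 138, CUP 2000,
  §3.B p. 32. [Woess2000]
-/

noncomputable section

namespace Literature.GroupTheory.Nilpotent

open SimpleGraph Literature.Barriers.CriticalPhenomena
open scoped Classical

section CommGroup

variable {A : Type*} [CommGroup A]

/-- **Exponent vectors along a walk.**  In `Cay(A;T)`, `A` abelian, for every walk of length `ℓ`
from `u` to `v` there is `a : T → ℤ` with `|a_t| ≤ ℓ` for all `t` and `u⁻¹ v = ∏_{t ∈ T} t^{a_t}`.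
[cite: WolfGrowth1968, §3 (abelian case)] -/
theorem exists_exponents_of_walk (T : Finset A) {u v : A} (w : (mulCayley (↑T : Set A)).Walk u v) :
    ∃ a : T → ℤ, (∀ t, |a t| ≤ w.length) ∧ u⁻¹ * v = ∏ t : T, (t : A) ^ (a t) := by
  induction w with
  | nil => exact ⟨0, fun t => by simp, by simp⟩
  | @cons x y z hadj w' ih =>
    obtain ⟨a', ha', hprod⟩ := ih
    rw [Walk.length_cons]
    obtain ⟨-, hs⟩ := (mulCayley_adj _ x y).1 hadj
    -- `y = x s` with `s = x⁻¹ y`, and `s ∈ T` or `s⁻¹ ∈ T`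
    have key : ∀ (t₀ : T) (ε : ℤ), (ε = 1 ∨ ε = -1) → x⁻¹ * y = (t₀ : A) ^ ε →
        ∃ a : T → ℤ, (∀ t, |a t| ≤ ((w'.length + 1 : ℕ) : ℤ)) ∧ x⁻¹ * z = ∏ t : T, (t : A) ^ (a t) := by
      intro t₀ ε hε hxy
      refine ⟨a' + Pi.single t₀ ε, fun t => ?_, ?_⟩
      · rw [Pi.add_apply]
        have h1 : |Pi.single (M := fun _ : T => ℤ) t₀ ε t| ≤ 1 := by
          by_cases h : t = t₀
          · subst h; rw [Pi.single_eq_same]; rcases hε with rfl | rfl <;> simp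
          · rw [Pi.single_eq_of_ne h]; simp
        have := ha' t
        calc |a' t + Pi.single (M := fun _ : T => ℤ) t₀ ε t| ≤ |a' t| + |Pi.single (M := fun _ : T => ℤ) t₀ ε t| :=
              abs_add_le _ _
          _ ≤ (w'.length : ℤ) + 1 := add_le_add this h1
          _ = ((w'.length + 1 : ℕ) : ℤ) := by push_cast; ring
      · have e : x⁻¹ * z = (x⁻¹ * y) * (y⁻¹ * z) := by group
        rw [e, hxy, hprod]
        have hsplit : (∏ t : T, (t : A) ^ ((a' + Pi.single (M := fun _ : T => ℤ) t₀ ε) t)) =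
            (∏ t : T, (t : A) ^ (a' t)) * ∏ t : T, (t : A) ^ (Pi.single (M := fun _ : T => ℤ) t₀ ε t) := by
          rw [← Finset.prod_mul_distrib]
          refine Finset.prod_congr rfl fun t _ => ?_
          rw [Pi.add_apply, zpow_add]
        have hsingle : (∏ t : T, (t : A) ^ (Pi.single (M := fun _ : T => ℤ) t₀ ε t)) = (t₀ : A) ^ ε := by
          rw [Finset.prod_eq_single t₀]
          · rw [Pi.single_eq_same]
          · intro t _ ht; rw [Pi.single_eq_of_ne ht, zpow_zero]
          · intro h; exact absurd (Finset.mem_univ t₀) h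
        rw [hsplit, hsingle, mul_comm]
    rcases hs with hs | hs
    · exact key ⟨x⁻¹ * y, hs⟩ 1 (Or.inl rfl) (by rw [zpow_one])
    · exact key ⟨y⁻¹ * x, hs⟩ (-1) (Or.inr rfl) (by rw [zpow_neg, zpow_one, mul_inv_rev, inv_inv])

/-- **Growth of a finitely generated abelian group**: `|B_T(1,n)| ≤ (2n+1)^{|T|}` in `Cay(A;T)`,
`A` abelian, `T` finite (every element of the ball is `∏_{t∈T} t^{a_t}` with `|a_t| ≤ n`).
[cite: WolfGrowth1968, §3] [cite: Woess2000, §3.B p. 32] -/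
theorem ballVolume_mulCayley_le_of_commGroup (T : Finset A) (n : ℕ) :
    ballVolume (mulCayley (↑T : Set A)) 1 n ≤ (2 * n + 1) ^ T.card := by
  let box : Finset (T → ℤ) := Fintype.piFinset fun _ : T => Finset.Icc (-(n : ℤ)) n
  let f : (T → ℤ) → A := fun a => ∏ t : T, (t : A) ^ (a t)
  have hsub : graphBall (mulCayley (↑T : Set A)) 1 n ⊆ ↑(box.image f) := by
    rintro g ⟨w, hw⟩
    obtain ⟨a, ha, hprod⟩ := exists_exponents_of_walk T w
    rw [inv_one, one_mul] at hprod
    rw [Finset.coe_image]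
    refine ⟨a, ?_, hprod.symm⟩
    rw [Finset.mem_coe, Fintype.mem_piFinset]
    intro t
    rw [Finset.mem_Icc, ← abs_le]
    exact (ha t).trans (by exact_mod_cast hw)
  have hbox : box.card = (2 * n + 1) ^ T.card := by
    rw [Fintype.card_piFinset, Finset.prod_const, Finset.card_univ, Fintype.card_coe, Int.card_Icc]
    congr 1
    omega
  calc ballVolume (mulCayley (↑T : Set A)) 1 n
      ≤ (↑(box.image f) : Set A).ncard := Set.ncard_le_ncard hsub (Finset.finite_toSet _)
    _ = (box.image f).card := Set.ncard_coe_finset _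
    _ ≤ box.card := Finset.card_image_le
    _ = (2 * n + 1) ^ T.card := hbox

/-- **Polynomial growth of a finitely generated abelian group**, in the `∃ C D, |B(1,n)| ≤ C (n+1)^D`
form consumed downstream (`C = 2^{|T|}`, `D = |T|`). [cite: WolfGrowth1968, §3] [cite: Woess2000, §3.B p. 32] -/
theorem exists_polynomialGrowth_of_commGroup (T : Finset A) :
    ∃ C D : ℝ, ∀ n : ℕ, (ballVolume (mulCayley (↑T : Set A)) 1 n : ℝ) ≤ C * ((n : ℝ) + 1) ^ D := by
  refine ⟨(2 : ℝ) ^ T.card, T.card, fun n => ?_⟩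
  have h := ballVolume_mulCayley_le_of_commGroup T n
  have h' : (ballVolume (mulCayley (↑T : Set A)) 1 n : ℝ) ≤ ((2 * n + 1 : ℕ) : ℝ) ^ T.card := by
    exact_mod_cast h
  rw [Real.rpow_natCast]
  refine h'.trans ?_
  rw [← mul_pow]
  exact pow_le_pow_left₀ (by positivity) (by push_cast; linarith) _

end CommGroup

section IsMulCommutative

variable {A : Type*} [Group A] [IsMulCommutative A]

/-- `|B_T(1,n)| ≤ (2n+1)^{|T|}` for a group that `IsMulCommutative` (the mixin form used by the
tree's nilpotent-group files, e.g. for abelian sections). [cite: WolfGrowth1968, §3] -/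
theorem ballVolume_mulCayley_le_of_isMulCommutative (T : Finset A) (n : ℕ) :
    ballVolume (mulCayley (↑T : Set A)) 1 n ≤ (2 * n + 1) ^ T.card := by
  letI : CommGroup A := { ‹Group A› with mul_comm := mul_comm' }
  exact ballVolume_mulCayley_le_of_commGroup T n

/-- Polynomial growth, `∃ C D` form, for a group that `IsMulCommutative`. [cite: WolfGrowth1968, §3] -/
theorem exists_polynomialGrowth_of_isMulCommutative (T : Finset A) :
    ∃ C D : ℝ, ∀ n : ℕ, (ballVolume (mulCayley (↑T : Set A)) 1 n : ℝ) ≤ C * ((n : ℝ) + 1) ^ D := by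
  letI : CommGroup A := { ‹Group A› with mul_comm := mul_comm' }
  exact exists_polynomialGrowth_of_commGroup T

end IsMulCommutative

end Literature.GroupTheory.Nilpotent

end
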